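import Summits.MatrixMultiplication.OmegaCensus.DominoStructureChar
import HarnessLib

/-!
# Mate determination for domino cube law triples: `U` is determined by `T` and the two holes

ω-census `pub-omega`, family (b3), seat pub-omega-group gen 6.  Framing: lottery ticket; floor = certified bounds/negative
ranges.  VALUE: a uniqueness theorem about the group-theoretic method (and the correctness core of the cell's structured
census engine); NOT progress on ω.

In the additive system of `DominoStructure.lean` — near-tilings `(T₀+U₀) ⊔ (T₁+U₀) ⊔ (T₀+U₁) = A ∖ {x₀}` and
`(T₁+U₁) ⊔ (T₀+U₁) ⊔ (T₁+U₀) = A ∖ {x₇}` — the character sums satisfy, with `π = τ₀ + τ₁` and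
`Δ = τ₀² + τ₀τ₁ + τ₁²` (the determinant of `[[π, τ₀],[τ₁, π]]`),
`Δ·υ₀ = τ₀ψ(x₇) − πψ(x₀)` and `Δ·υ₁ = τ₁ψ(x₀) − πψ(x₇)` (`charsum_mate_eqs`), and `Δ ≠ 0` at every character when
`3 ∤ |A|` (`CubeRootObstruction`).  Hence (**`domino_mates_unique`**) for given `T₀, T₁, x₀, x₇` there is at most ONE pair
`(U₀, U₁)` of sets of prescribed size satisfying the two unit equations at every non-trivial character — the analogue, for
the three-piece near-factorisations coming from TPP law triples, of the uniqueness of mates in near-factorisations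
(Kreher–Martin–Stinson, arXiv:2411.15890, Thm 1.5).  In group-ring terms: `U₀ = Δ⁻¹(d·A + T₀[x₇] − (T₀+T₁)[x₀])`.
-/

namespace Summit.MatrixMultiplication.OmegaCensus

open Finset

section Mate

variable {A : Type*} [AddCommGroup A] [Fintype A] [DecidableEq A]

omit [Fintype A] [DecidableEq A] [AddCommGroup A] in
/-- Cramer's rule for the `2 × 2` system `π u₀ + t₀ u₁ = c₀`, `t₁ u₀ + π u₁ = c₇`. [folklore] -/
theorem cramer₂ {π t₀ t₁ u₀ u₁ c₀ c₇ : ℂ} (h1 : π * u₀ + t₀ * u₁ = c₀) (h2 : t₁ * u₀ + π * u₁ = c₇) :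
    (π ^ 2 - t₀ * t₁) * u₀ = π * c₀ - t₀ * c₇ ∧ (π ^ 2 - t₀ * t₁) * u₁ = π * c₇ - t₁ * c₀ := by
  constructor
  · linear_combination π * h1 - t₀ * h2
  · linear_combination π * h2 - t₁ * h1

/-- **Mate equations.** From the two unit equations: `Δ υ₀ = τ₀ ψ(x₇)·(−1)·(−1)…`; precisely
`Δ·υ₀ = τ₀·ψ x₇ − π·ψ x₀` and `Δ·υ₁ = τ₁·ψ x₀ − π·ψ x₇` with `Δ = τ₀² + τ₀τ₁ + τ₁²`, `π = τ₀ + τ₁`. [folklore] -/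
theorem charsum_mate_eqs {τ₀ τ₁ υ₀ υ₁ p₀ p₇ : ℂ}
    (h1 : (τ₀ + τ₁) * υ₀ + τ₀ * υ₁ = -p₀) (h2 : τ₁ * υ₀ + (τ₀ + τ₁) * υ₁ = -p₇) :
    (τ₀ ^ 2 + τ₀ * τ₁ + τ₁ ^ 2) * υ₀ = τ₀ * p₇ - (τ₀ + τ₁) * p₀ ∧
      (τ₀ ^ 2 + τ₀ * τ₁ + τ₁ ^ 2) * υ₁ = τ₁ * p₀ - (τ₀ + τ₁) * p₇ := by
  constructor
  · linear_combination (τ₀ + τ₁) * h1 - τ₀ * h2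
  · linear_combination (τ₀ + τ₁) * h2 - τ₁ * h1

/-- **Uniqueness of mates.**  `3 ∤ |A|`; two pairs `(U₀, U₁)`, `(U₀′, U₁′)` with `|U₀| = |U₀′|`, `|U₁| = |U₁′|` satisfying the
two unit equations for the same `T₀, T₁, x₀, x₇` at every non-trivial character coincide. [folklore] -/
theorem domino_mates_unique (h3 : ¬ 3 ∣ Fintype.card A) {T₀ T₁ U₀ U₁ U₀' U₁' : Finset A} {x₀ x₇ : A}
    (hU₀ : U₀.card = U₀'.card) (hU₁ : U₁.card = U₁'.card)
    (h1 : ∀ ψ : AddChar A ℂ, ψ ≠ 0 →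
      ((∑ a ∈ T₀, ψ a) + ∑ a ∈ T₁, ψ a) * (∑ a ∈ U₀, ψ a) + (∑ a ∈ T₀, ψ a) * (∑ a ∈ U₁, ψ a) = -ψ x₀)
    (h2 : ∀ ψ : AddChar A ℂ, ψ ≠ 0 →
      (∑ a ∈ T₁, ψ a) * (∑ a ∈ U₀, ψ a) + ((∑ a ∈ T₀, ψ a) + ∑ a ∈ T₁, ψ a) * (∑ a ∈ U₁, ψ a) = -ψ x₇)
    (h1' : ∀ ψ : AddChar A ℂ, ψ ≠ 0 →
      ((∑ a ∈ T₀, ψ a) + ∑ a ∈ T₁, ψ a) * (∑ a ∈ U₀', ψ a) + (∑ a ∈ T₀, ψ a) * (∑ a ∈ U₁', ψ a) = -ψ x₀)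
    (h2' : ∀ ψ : AddChar A ℂ, ψ ≠ 0 →
      (∑ a ∈ T₁, ψ a) * (∑ a ∈ U₀', ψ a) + ((∑ a ∈ T₀, ψ a) + ∑ a ∈ T₁, ψ a) * (∑ a ∈ U₁', ψ a) = -ψ x₇) :
    U₀ = U₀' ∧ U₁ = U₁' := by
  have main : ∀ ψ : AddChar A ℂ, ψ ≠ 0 → (∑ a ∈ U₀, ψ a) = ∑ a ∈ U₀', ψ a ∧ (∑ a ∈ U₁, ψ a) = ∑ a ∈ U₁', ψ a := by
    intro ψ hψ
    set τ₀ := ∑ a ∈ T₀, ψ a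
    set τ₁ := ∑ a ∈ T₁, ψ a
    obtain ⟨e0, e1⟩ := charsum_mate_eqs (h1 ψ hψ) (h2 ψ hψ)
    obtain ⟨e0', e1'⟩ := charsum_mate_eqs (h1' ψ hψ) (h2' ψ hψ)
    -- `Δ ≠ 0`: otherwise `τ₀ = τ₁ = 0` by Lemma Ω and the first unit equation reads `0 = −ψ x₀`.
    have hΔ : τ₀ ^ 2 + τ₀ * τ₁ + τ₁ ^ 2 ≠ 0 := by
      intro h0
      obtain ⟨ht0, ht1⟩ := charsum_sq_add_mul_add_sq_eq_zero h3 ψ T₀ T₁ h0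
      have := h1 ψ hψ
      rw [ht0, ht1] at this
      have hx : ψ x₀ * ψ (-x₀) = 1 := by rw [← AddChar.map_add_eq_mul, add_neg_cancel, AddChar.map_zero_eq_one]
      have h00 : ψ x₀ = 0 := by linear_combination this
      rw [h00, zero_mul] at hx
      exact zero_ne_one hx
    constructor
    · exact mul_left_cancel₀ hΔ (e0.trans e0'.symm)
    · exact mul_left_cancel₀ hΔ (e1.trans e1'.symm)
  constructor
  · refine finset_eq_of_charsum_eq fun ψ => ?_
    by_cases hψ : ψ = 0
    · subst hψ; simp only [AddChar.zero_apply, sum_const, nsmul_eq_mul, mul_one]; exact_mod_cast hU₀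
    · exact (main ψ hψ).1
  · refine finset_eq_of_charsum_eq fun ψ => ?_
    by_cases hψ : ψ = 0
    · subst hψ; simp only [AddChar.zero_apply, sum_const, nsmul_eq_mul, mul_one]; exact_mod_cast hU₁
    · exact (main ψ hψ).2

end Mate

end Summit.MatrixMultiplication.OmegaCensus
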